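import Mathlib
import HarnessLib
import Summits.ValiantsHypothesis.ValiantsHypothesis.Theses.ForgivenCollisions
import Literature.Barriers.ValiantsHypothesis.MonotoneGapDecomposition
import Literature.Barriers.ValiantsHypothesis.MonotoneGapPermanentLower
import Literature.Barriers.ValiantsHypothesis.ShiftedPartialsCaseC2

/-! # Route ForgivenCollisions — support `MonotoneEndpoint` (stmt-ValiantsHypothesis-11733)

The `r = ∞` endpoint of the monotone syndrome law: for `n ≥ 3`, every fan-in-two circuit over
`ℝ≥0` computing a HOMOGENEOUS degree-`n` polynomial `f ∈ ℝ≥0[X_n]` that agrees with `per_n` at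
every exponent without a tripled row or column has at least `C(n, ⌊n/3⌋)` product gates.

Proof (Jerrum–Snir type, [JerrumSnir1982, §3–§4.3]). By the tree's structure theorem
`Literature.Barriers.ValiantsHypothesis.exists_decomposition` with `m = ⌊n/3⌋`:
`f = Σ_{t ∈ L} a_t b_t`, `|L| ≤ prodCount P`, `m < deg a_t ≤ 2m`. Over `ℝ≥0` nothing cancels
(`JerrumSnir.support_mul_eq`, `JerrumSnir.mem_support_list_sum`), so every permutation monomial
`x_σ` (coefficient `1` in `f`) splits as `α + β` with `α ∈ supp a_t`, `β ∈ supp b_t` for some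
`t` ("gate `t` covers `σ`"). Fix `t` and one covered
`σ₀`, `α₀ + β₀ = x_{σ₀}`. For any covered `σ`, `α + β = x_σ`, the cross sums `α + β₀` and
`α₀ + β` lie in `supp f` and have all row and column counts `≤ 2`, so by the agreement
hypothesis they are permutation monomials; Jerrum–Snir's partition lemma
(`JerrumSnir.card_le_factorial_of_add_mem`) bounds the `α`'s by `d!` and the `β`'s by `(n-d)!`
with `d = deg α₀ = deg a_t ∈ (m, 2m]` (`f` homogeneous forces `a_t` homogeneous), so gate `t`
covers at most `d! (n-d)! = n!/C(n,d) ≤ n!/C(n,m)` permutations, and `C(n,m) ≤ |L|`.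
Plainness of the sum gates is not used.
-/

noncomputable section

-- `Summit.ValiantsHypothesis.ValiantsHypothesis.…` is the tree's mandated namespace (Sub = Summit).
set_option linter.dupNamespace false

namespace Summit.ValiantsHypothesis.ValiantsHypothesis.Theorems

open Literature.Computability.AlgebraicComplexity MvPolynomial Finset
open Literature.Barriers.ValiantsHypothesis
open scoped NNReal Pointwise

namespace ForgivenCollisionsMonotoneEndpoint

/-! ### Binomial coefficients on the middle third -/

/-- For `m < d ≤ 2m` and `3m ≤ n`: `C(n, m) ≤ C(n, d)` (monotonicity of `C(n, ·)` below `n/2`,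
`Literature.Barriers.ValiantsHypothesis.choose_le_choose_of_le_half`, and symmetry). -/
theorem choose_le_choose_of_third {n m d : ℕ} (hmd : m < d) (hd : d ≤ 2 * m) (hm : 3 * m ≤ n) :
    n.choose m ≤ n.choose d := by
  rcases le_or_gt d (n / 2) with h | h
  · exact choose_le_choose_of_le_half hmd.le h
  · rw [← Nat.choose_symm (show d ≤ n by omega)]
    exact choose_le_choose_of_le_half (by omega) (by omega)

/-! ### The permutations covered by one product -/

variable {n : ℕ}

/-- **One product covers at most `n!/C(n,m)` permutations.** Let `S` be a set of permutations
covered by the product `a · b` (every `x_σ`, `σ ∈ S`, splits as `α + β` with `α ∈ supp a`,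
`β ∈ supp b`). If `supp a + supp b ⊆ supp f`, every monomial of `f` has degree `n`, every
monomial of `f` with all row and column counts `≤ 2` is a permutation monomial, and
`m < deg a ≤ 2m`, `3m ≤ n`, then `|S| · C(n, m) ≤ n!`. -/
theorem card_covered_mul_choose_le {f a b : MvPolynomial (Fin n × Fin n) ℝ≥0} {m : ℕ}
    {S : Finset (Equiv.Perm (Fin n))}
    (hS : ∀ σ ∈ S, ∃ α ∈ a.support, ∃ β ∈ b.support, α + β = permMonomial σ)
    (hsub : ∀ α ∈ a.support, ∀ β ∈ b.support, α + β ∈ f.support)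
    (hper : ∀ d ∈ f.support, (∀ i, rowCount d i ≤ 2) → (∀ j, colCount d j ≤ 2) →
      ∃ σ : Equiv.Perm (Fin n), permMonomial σ = d)
    (hhom : ∀ d ∈ f.support, d.degree = n)
    (hlo : m < a.totalDegree) (hhi : a.totalDegree ≤ 2 * m) (hm3 : 3 * m ≤ n) :
    S.card * n.choose m ≤ n.factorial := by
  classical
  rcases S.eq_empty_or_nonempty with h0 | ⟨σ₀, hσ₀⟩
  · simp [h0]
  obtain ⟨α₀, hα₀, β₀, hβ₀, h₀⟩ := hS σ₀ hσ₀
  -- cross sums of rook-legal pieces are permutation monomials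
  have hcross : ∀ α ∈ a.support, ∀ β ∈ b.support,
      (∃ (σ : Equiv.Perm (Fin n)) (β' : Fin n × Fin n →₀ ℕ), α + β' = permMonomial σ) →
      (∃ (σ : Equiv.Perm (Fin n)) (α' : Fin n × Fin n →₀ ℕ), α' + β = permMonomial σ) →
      ∃ σ : Equiv.Perm (Fin n), α + β = permMonomial σ := by
    rintro α hα β hβ ⟨σ₁, β', h₁⟩ ⟨σ₂, α', h₂⟩
    have hrow : ∀ i, rowCount (α + β) i ≤ 2 := by
      intro i
      have e₁ := congrArg (fun d => rowCount d i) h₁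
      have e₂ := congrArg (fun d => rowCount d i) h₂
      simp only [rowCount_add, rowCount_permMonomial] at e₁ e₂
      rw [rowCount_add]; omega
    have hcol : ∀ j, colCount (α + β) j ≤ 2 := by
      intro j
      have e₁ := congrArg (fun d => colCount d j) h₁
      have e₂ := congrArg (fun d => colCount d j) h₂
      simp only [colCount_add, colCount_permMonomial] at e₁ e₂
      rw [colCount_add]; omega
    obtain ⟨σ, hσ⟩ := hper (α + β) (hsub α hα β hβ) hrow hcol
    exact ⟨σ, hσ.symm⟩
  -- the two blocks of the partition argument
  set A := a.support.filter fun α => ∃ σ : Equiv.Perm (Fin n), α + β₀ = permMonomial σ with hA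
  set B := b.support.filter fun β => ∃ σ : Equiv.Perm (Fin n), β + α₀ = permMonomial σ with hB
  have hα₀A : α₀ ∈ A := Finset.mem_filter.mpr ⟨hα₀, σ₀, h₀⟩
  have hβ₀B : β₀ ∈ B := Finset.mem_filter.mpr ⟨hβ₀, σ₀, by rw [add_comm]; exact h₀⟩
  obtain ⟨hAcard, hdegAB⟩ := JerrumSnir.card_le_factorial_of_add_mem
    (A := A) (e := β₀) (a₀ := α₀) (fun α hα => (Finset.mem_filter.mp hα).2) hα₀A
  obtain ⟨hBcard, -⟩ := JerrumSnir.card_le_factorial_of_add_mem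
    (A := B) (e := α₀) (a₀ := β₀) (fun β hβ => (Finset.mem_filter.mp hβ).2) hβ₀B
  -- `S` injects into `A × B`
  have hinj : S.card ≤ A.card * B.card := by
    have key : ∀ σ ∈ S, ∃ p ∈ A ×ˢ B, p.1 + p.2 = permMonomial σ := by
      intro σ hσ
      obtain ⟨α, hα, β, hβ, h⟩ := hS σ hσ
      refine ⟨(α, β), Finset.mem_product.mpr ⟨?_, ?_⟩, h⟩
      · exact Finset.mem_filter.mpr ⟨hα, hcross α hα β₀ hβ₀ ⟨σ, β, h⟩ ⟨σ₀, α₀, h₀⟩⟩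
      · refine Finset.mem_filter.mpr ⟨hβ, ?_⟩
        obtain ⟨τ, hτ⟩ := hcross α₀ hα₀ β hβ ⟨σ₀, β₀, h₀⟩ ⟨σ, α, h⟩
        exact ⟨τ, by rw [add_comm]; exact hτ⟩
    choose! g hg hgsum using key
    rw [← Finset.card_product]
    refine Finset.card_le_card_of_injOn g (fun σ hσ => hg σ hσ) ?_
    intro σ hσ τ hτ hστ
    apply permMonomial_injective
    rw [← hgsum σ hσ, ← hgsum τ hτ, hστ]
  -- the degree `d = deg α₀ = deg a` lies in `(m, 2m]`
  have hd_le : α₀.degree ≤ 2 * m := by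
    have h : α₀.degree ≤ a.totalDegree := by
      rw [Finsupp.degree_apply]; exact le_totalDegree hα₀
    exact h.trans hhi
  have hd_gt : m < α₀.degree := by
    obtain ⟨α₁, hα₁, hsup⟩ :=
      Finset.exists_mem_eq_sup a.support ⟨α₀, hα₀⟩ (fun s : Fin n × Fin n →₀ ℕ => s.sum fun _ e => e)
    have h1 : (α₁ + β₀).degree = n := hhom _ (hsub α₁ hα₁ β₀ hβ₀)
    have h2 : (α₀ + β₀).degree = n := hhom _ (hsub α₀ hα₀ β₀ hβ₀)
    rw [map_add] at h1 h2
    have h3 : a.totalDegree = α₁.degree := by rw [Finsupp.degree_apply]; exact hsup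
    omega
  have hdn : α₀.degree ≤ n := by omega
  have hchoose : n.choose m ≤ n.choose α₀.degree := choose_le_choose_of_third hd_gt hd_le hm3
  have hβdeg : β₀.degree = n - α₀.degree := by omega
  calc S.card * n.choose m
      ≤ (α₀.degree.factorial * β₀.degree.factorial) * n.choose α₀.degree :=
        Nat.mul_le_mul (hinj.trans (Nat.mul_le_mul hAcard hBcard)) hchoose
    _ = n.factorial := by
        rw [hβdeg, ← Nat.choose_mul_factorial_mul_factorial hdn]; ring

end ForgivenCollisionsMonotoneEndpoint

open ForgivenCollisionsMonotoneEndpoint in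
/-- **MONOTONE ENDPOINT** (support item stmt-ValiantsHypothesis-11733 of route ForgivenCollisions):
for `n ≥ 3`, every monotone computation (fan-in-two circuit over `ℝ≥0` with plain sum gates) of
a homogeneous degree-`n` polynomial `f ∈ ℝ≥0[X_n]` agreeing with `per_n` at every exponent
without a tripled line has at least `C(n, ⌊n/3⌋)` product gates. -/
theorem monotoneEndpoint_proof :
    Summit.ValiantsHypothesis.ValiantsHypothesis.Theses.ForgivenCollisions.MonotoneEndpoint := by
  unfold Summit.ValiantsHypothesis.ValiantsHypothesis.Theses.ForgivenCollisions.MonotoneEndpoint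
  intro n hn f P hf hagree hP
  classical
  obtain ⟨h2, -, hcomp⟩ := hP
  have heval : P.eval = f := hcomp
  subst heval
  -- the item's product-gate count is the tree's `prodCount`
  have hgoal : ∀ F : ArithCircuit.Gate ℝ≥0 (Fin n × Fin n) → Bool,
      (∀ g, F g = isProdGate g) → n.choose (n / 3) ≤ prodCount P →
        n.choose (n / 3) ≤ P.gates.countP F := by
    intro F hF h
    have hF' : F = fun g => isProdGate g := funext hF
    subst hF'
    exact h
  refine hgoal _ (fun g => by cases g <;> rfl) ?_
  set m := n / 3 with hm_def
  have hm : 1 ≤ m := by omega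
  have hmn : m < n := by omega
  have hm3 : 3 * m ≤ n := by omega
  obtain ⟨L, hLlen, hLsum, hLdeg⟩ :=
    Literature.Barriers.ValiantsHypothesis.exists_decomposition hm hmn (prodCount P) P le_rfl h2 hf
  -- `S ab`: the permutations covered by the product `ab.1 * ab.2`
  obtain ⟨S, hS⟩ : ∃ S : MvPolynomial (Fin n × Fin n) ℝ≥0 × MvPolynomial (Fin n × Fin n) ℝ≥0 →
      Finset (Equiv.Perm (Fin n)), ∀ ab σ, σ ∈ S ab ↔
        ∃ α ∈ ab.1.support, ∃ β ∈ ab.2.support, α + β = permMonomial σ :=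
    ⟨fun ab => Finset.univ.filter fun σ =>
        ∃ α ∈ ab.1.support, ∃ β ∈ ab.2.support, α + β = permMonomial σ,
      fun ab σ => by simp only [Finset.mem_filter, Finset.mem_univ, true_and]⟩
  -- every permutation is covered by some product of `L`
  have hcov : ∀ σ : Equiv.Perm (Fin n), ∃ ab ∈ L, σ ∈ S ab := by
    intro σ
    have hne : coeff (permMonomial σ) P.eval ≠ 0 := by
      rw [hagree (permMonomial σ) ?_, coeff_permMonomial_perPoly]
      · exact one_ne_zero
      · rintro (⟨i, hi⟩ | ⟨j, hj⟩)
        · rw [rowCount_permMonomial] at hi; omega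
        · rw [colCount_permMonomial] at hj; omega
    have hmem : permMonomial σ ∈ P.eval.support := mem_support_iff.mpr hne
    rw [hLsum] at hmem
    obtain ⟨p, hp, hpσ⟩ := JerrumSnir.mem_support_list_sum.mp hmem
    obtain ⟨ab, hab, rfl⟩ := List.mem_map.mp hp
    obtain ⟨α, hα, β, hβ, hαβ⟩ := Finset.mem_add.mp (support_mul ab.1 ab.2 hpσ)
    exact ⟨ab, hab, (hS ab σ).mpr ⟨α, hα, β, hβ, hαβ⟩⟩
  -- the hypotheses of the per-product bound
  have hper : ∀ d ∈ P.eval.support, (∀ i, rowCount d i ≤ 2) → (∀ j, colCount d j ≤ 2) →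
      ∃ σ : Equiv.Perm (Fin n), permMonomial σ = d := by
    intro d hd hrow hcol
    apply exists_permMonomial_eq_of_coeff_perPoly_ne_zero ℝ≥0
    rw [← hagree d ?_]
    · exact mem_support_iff.mp hd
    · rintro (⟨i, hi⟩ | ⟨j, hj⟩)
      · have := hrow i; omega
      · have := hcol j; omega
  have hhom' : ∀ d ∈ P.eval.support, d.degree = n := by
    intro d hd
    by_contra hne
    exact (mem_support_iff.mp hd) (hf.coeff_eq_zero hne)
  have hsub : ∀ ab ∈ L, ∀ α ∈ ab.1.support, ∀ β ∈ ab.2.support, α + β ∈ P.eval.support := by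
    intro ab hab α hα β hβ
    have h1 : α + β ∈ (ab.1 * ab.2).support := by
      rw [JerrumSnir.support_mul_eq]
      exact Finset.add_mem_add hα hβ
    rw [hLsum]
    exact JerrumSnir.mem_support_list_sum.mpr ⟨_, List.mem_map.mpr ⟨ab, hab, rfl⟩, h1⟩
  have hbound : ∀ ab ∈ L, (S ab).card * n.choose m ≤ n.factorial := fun ab hab =>
    card_covered_mul_choose_le (fun σ hσ => (hS ab σ).mp hσ) (hsub ab hab) hper hhom'
      (hLdeg ab hab).1 (hLdeg ab hab).2 hm3
  -- counting
  have huniv : (Finset.univ : Finset (Equiv.Perm (Fin n))) ⊆ L.toFinset.biUnion S := by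
    intro σ _
    obtain ⟨ab, hab, hσ⟩ := hcov σ
    exact Finset.mem_biUnion.mpr ⟨ab, List.mem_toFinset.mpr hab, hσ⟩
  have hcard : n.factorial ≤ ∑ ab ∈ L.toFinset, (S ab).card := by
    calc n.factorial = (Finset.univ : Finset (Equiv.Perm (Fin n))).card := by
          rw [Finset.card_univ, Fintype.card_perm, Fintype.card_fin]
      _ ≤ (L.toFinset.biUnion S).card := Finset.card_le_card huniv
      _ ≤ ∑ ab ∈ L.toFinset, (S ab).card := Finset.card_biUnion_le
  have hfin : n.factorial * n.choose m ≤ n.factorial * prodCount P := by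
    calc n.factorial * n.choose m
        ≤ (∑ ab ∈ L.toFinset, (S ab).card) * n.choose m :=
          Nat.mul_le_mul_right _ hcard
      _ = ∑ ab ∈ L.toFinset, (S ab).card * n.choose m := Finset.sum_mul ..
      _ ≤ ∑ ab ∈ L.toFinset, n.factorial :=
          Finset.sum_le_sum fun ab hab => hbound ab (List.mem_toFinset.mp hab)
      _ = L.toFinset.card * n.factorial := by rw [Finset.sum_const, smul_eq_mul]
      _ ≤ prodCount P * n.factorial :=
          Nat.mul_le_mul_right _ (le_trans (List.toFinset_card_le L) hLlen)
      _ = n.factorial * prodCount P := mul_comm _ _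
  exact Nat.le_of_mul_le_mul_left hfin (Nat.factorial_pos n)

end Summit.ValiantsHypothesis.ValiantsHypothesis.Theorems
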